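import Literature.Combinatorics.Optimization.CardinalityMatchingPolytopeDescription
import Mathlib.Analysis.Convex.Join
import HarnessLib

/-!
# Matchings with a cardinality RANGE: `conv{χ^M : k ≤ |M| ≤ l} = P_match(G) ∩ {k ≤ x(E) ≤ l}`
# for every finite simple graph — PROVED (from the `ℓ`-slice theorem)

`CardinalityMatchingPolytopeDescription.lean` proves, for every finite simple graph `G` and every `ℓ`,
the inequality description of the cardinality-`ℓ` matching polytope:
`conv{χ^M : |M| = ℓ} = P_match(G) ∩ {x(E) = ℓ}` (`CardMatchingSlice.convexHull_cardMatchingVectorsOf_eq`;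
[KaibelWalter2017, §3 (arXiv p. 6)]; the bipartite version is Schrijver's §18.5f "Matchings of given
size" [Schrijver2003]).  THIS FILE adds the two-sided RANGE version left as `TODO(general form)` there:
for naturals `k ≤ l`,

  `conv{χ^M : M a matching of G, k ≤ |M| ≤ l} = {x ∈ P_match(G) : k ≤ x(E) ≤ l}`

(`convexHull_rangeMatchingVectors_eq`), together with the one-sided forms `x(E) ≤ l`
(`convexHull_matchingVectors_sum_le_eq`) and `k ≤ x(E)` (`convexHull_matchingVectors_le_sum_eq`), the
membership forms, and the vertex sets (`extremePoints_edmondsRange`).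

Proof (elementary convexity on top of the slice theorem, §2): let `x ∈ P_match(G)` with
`k ≤ x(E) = s ≤ l` and `m = ⌊s⌋`.  If `s = m` the slice theorem applies.  Otherwise `m < s < m + 1`;
write `x` as a convex combination of matchings (Edmonds' theorem, tree `edmondsPolytope_eq_convexHull`)
and group the matchings into those with `|M| ≤ m` and those with `|M| ≥ m + 1`: `x ∈ [a, b]` with
`a, b ∈ P_match(G)`, `a(E) ≤ m`, `b(E) ≥ m + 1` (Mathlib `convexHull_union` / `mem_convexJoin`).  On the
segment `t ↦ (1 − t)a + tb` the linear function `x(E)` increases from `a(E)` to `b(E)`, so it takes the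
values `m` and `m + 1` at parameters `t₁ ≤ θ ≤ t₂` around the parameter `θ` of `x`; the two points lie in
`P_match(G) ∩ {x(E) = m}` and `P_match(G) ∩ {x(E) = m + 1}`, i.e. (slice theorem) in
`conv{|M| = m}` and `conv{|M| = m + 1}`, and `x` lies between them.  Since `k ≤ m < m + 1 ≤ l`, both
slices consist of matchings in the range.

Everything is proved; no named fact (net debt 0).  Label: catalogue (classical polyhedral
combinatorics; nothing here concerns psd rank or P versus NP).

presearch: range statement — Schrijver 2003 Vol. A §18.5f (bipartite; volume not held, ToC seen in the
held Vol. B [galaxy panama:378532647665722]); general graphs, single slice: [corpus: paper:arxiv-1703.09505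
p. 6]; `lit search --hybrid "convex hull of matchings with size between k and l"` → KV 2018 pp. 279–287,
Handbook of Combinatorics ch. 3 pp. 209–214 (matching / perfect matching polytopes only); tree `rg
"k ≤ |M|"` → only the TODO line of the slice file.
-/

noncomputable section

open Finset

namespace Literature.Combinatorics.Optimization

namespace CardMatchingSlice

open StephenTuncel1999 PerfectMatchingPolytope

variable {V : Type*} [Fintype V] [DecidableEq V] {G : SimpleGraph V} [DecidableRel G.Adj]

/-! ## §1. Matching vectors with `k ≤ |M| ≤ l` and the range slab of Edmonds' polytope -/

variable (G) in
/-- The incidence vectors of the matchings `M` of `G` with `k ≤ |M| ≤ l`.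
[cite: Schrijver2003, §18.5f (the bipartite case)] [cite: KaibelWalter2017, §3 (arXiv p. 6)] -/
def rangeMatchingVectors (k l : ℕ) : Set (G.edgeSet → ℝ) :=
  {x | x ∈ matchingVectors G ∧ (k : ℝ) ≤ ∑ e, x e ∧ ∑ e, x e ≤ l}

variable (G) in
/-- The slab `P_match(G) ∩ {k ≤ x(E) ≤ l}` of Edmonds' matching polytope.
[cite: Schrijver2003, §18.5f (the bipartite case)] [cite: KaibelWalter2017, §3 (arXiv p. 6)] -/
def edmondsRange (k l : ℕ) : Set (G.edgeSet → ℝ) :=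
  {x | x ∈ edmondsPolytope G ∧ (k : ℝ) ≤ ∑ e, x e ∧ ∑ e, x e ≤ l}

/-- The easy inclusion. [cite: KaibelWalter2017, §3 (arXiv p. 6)] -/
theorem rangeMatchingVectors_subset_edmondsRange (k l : ℕ) :
    rangeMatchingVectors G k l ⊆ edmondsRange G k l := fun _ hx =>
  ⟨matchingVectors_subset_edmondsPolytope hx.1, hx.2⟩

omit [DecidableEq V] in
/-- `x(E)` along a segment: `((1 − θ)a + θb)(E) = (1 − θ)a(E) + θ b(E)`. [cite: KaibelWalter2017, §3 (arXiv p. 6)] -/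
theorem sum_combo (a b : G.edgeSet → ℝ) (θ : ℝ) :
    ∑ e, ((1 - θ) • a + θ • b) e = (1 - θ) * ∑ e, a e + θ * ∑ e, b e := by
  simp only [Pi.add_apply, Pi.smul_apply, smul_eq_mul, Finset.sum_add_distrib, Finset.mul_sum]

omit [DecidableEq V] in
/-- Half-spaces `x(E) ≤ c` are convex. [cite: KaibelWalter2017, §3 (arXiv p. 6)] -/
theorem convex_sum_le (c : ℝ) : Convex ℝ {x : G.edgeSet → ℝ | ∑ e, x e ≤ c} := by
  intro x hx y hy a b ha hb hab
  simp only [Set.mem_setOf_eq, Pi.add_apply, Pi.smul_apply, smul_eq_mul, Finset.sum_add_distrib,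
    ← Finset.mul_sum] at hx hy ⊢
  calc a * ∑ e, x e + b * ∑ e, y e ≤ a * c + b * c :=
        add_le_add (mul_le_mul_of_nonneg_left hx ha) (mul_le_mul_of_nonneg_left hy hb)
    _ = c := by rw [← add_mul, hab, one_mul]

omit [DecidableEq V] in
/-- Half-spaces `c ≤ x(E)` are convex. [cite: KaibelWalter2017, §3 (arXiv p. 6)] -/
theorem convex_le_sum (c : ℝ) : Convex ℝ {x : G.edgeSet → ℝ | c ≤ ∑ e, x e} := by
  intro x hx y hy a b ha hb hab
  simp only [Set.mem_setOf_eq, Pi.add_apply, Pi.smul_apply, smul_eq_mul, Finset.sum_add_distrib,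
    ← Finset.mul_sum] at hx hy ⊢
  calc c = a * c + b * c := by rw [← add_mul, hab, one_mul]
    _ ≤ a * ∑ e, x e + b * ∑ e, y e :=
        add_le_add (mul_le_mul_of_nonneg_left hx ha) (mul_le_mul_of_nonneg_left hy hb)

/-- The slab is convex. [cite: KaibelWalter2017, §3 (arXiv p. 6)] -/
theorem convex_edmondsRange (k l : ℕ) : Convex ℝ (edmondsRange G k l) := by
  have h : edmondsRange G k l = edmondsPolytope G ∩ ({x | (k : ℝ) ≤ ∑ e, x e} ∩ {x | ∑ e, x e ≤ l}) := by
    ext x; simp only [edmondsRange, Set.mem_setOf_eq, Set.mem_inter_iff]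
  rw [h]
  exact convex_edmondsPolytope.inter ((convex_le_sum _).inter (convex_sum_le _))

/-- A matching vector has a natural number of edges: `χ^M(E) = |M| ∈ ℕ`. [cite: Edmonds1965, §2 (p. 126)] -/
theorem exists_sum_eq_natCast {x : G.edgeSet → ℝ} (hx : x ∈ matchingVectors G) :
    ∃ n : ℕ, ∑ e, x e = n := by
  refine ⟨(univ.filter fun e => x e = 1).card, ?_⟩
  have h : ∀ e, x e = if x e = 1 then (1 : ℝ) else 0 := by
    intro e
    rcases hx.1 e with h0 | h1
    · rw [h0]; simp
    · rw [if_pos h1, h1]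
  rw [Finset.sum_congr rfl fun e _ => h e, Finset.sum_boole]

/-- The zero vector (the empty matching) is a matching vector. [cite: Edmonds1965, §2 (p. 126)] -/
theorem zero_mem_matchingVectors : (0 : G.edgeSet → ℝ) ∈ matchingVectors G :=
  ⟨fun _ => Or.inl rfl, fun _ => by simp⟩

/-- `ℓ`-matching vectors with `k ≤ ℓ ≤ l` are in the range. [cite: KaibelWalter2017, §3 (arXiv p. 6)] -/
theorem cardMatchingVectorsOf_subset_rangeMatchingVectors {k m l : ℕ} (hk : k ≤ m) (hl : m ≤ l) :
    cardMatchingVectorsOf G m ⊆ rangeMatchingVectors G k l := fun _ hx =>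
  ⟨hx.1, by rw [hx.2]; exact_mod_cast hk, by rw [hx.2]; exact_mod_cast hl⟩

/-! ## §2. Between two consecutive slices -/

/-- **Two consecutive slices.** A point `x` of Edmonds' polytope with `m < x(E) < m + 1` is a convex
combination of matchings with exactly `m` and exactly `m + 1` edges.
[cite: KaibelWalter2017, §3 (arXiv p. 6)] [cite: Edmonds1965, §2 Thm. (P) (p. 126)] -/
theorem mem_convexHull_union_slices {x : G.edgeSet → ℝ} (hx : x ∈ edmondsPolytope G) {m : ℕ}
    (h1 : (m : ℝ) < ∑ e, x e) (h2 : ∑ e, x e < m + 1) :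
    x ∈ convexHull ℝ (cardMatchingVectorsOf G m ∪ cardMatchingVectorsOf G (m + 1)) := by
  classical
  -- split the matchings by cardinality
  set A : Set (G.edgeSet → ℝ) := {y | y ∈ matchingVectors G ∧ ∑ e, y e ≤ m} with hA_def
  set B : Set (G.edgeSet → ℝ) := {y | y ∈ matchingVectors G ∧ (m : ℝ) + 1 ≤ ∑ e, y e} with hB_def
  have hAB : matchingVectors G = A ∪ B := by
    ext y
    constructor
    · intro hy
      obtain ⟨n, hn⟩ := exists_sum_eq_natCast hy
      rcases le_or_gt n m with hnm | hnm
      · exact Or.inl ⟨hy, by rw [hn]; exact_mod_cast hnm⟩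
      · exact Or.inr ⟨hy, by rw [hn]; exact_mod_cast hnm⟩
    · rintro (hy | hy)
      · exact hy.1
      · exact hy.1
  have hxconv : x ∈ convexHull ℝ (A ∪ B) := by
    rw [← hAB, ← edmondsPolytope_eq_convexHull]; exact hx
  have hA : A.Nonempty := ⟨0, zero_mem_matchingVectors, by simp⟩
  -- the hull of `A` stays below `m`, the hull of `B` above `m + 1`
  have hAle : convexHull ℝ A ⊆ {y : G.edgeSet → ℝ | ∑ e, y e ≤ m} :=
    convexHull_min (fun y hy => hy.2) (convex_sum_le _)
  have hBge : convexHull ℝ B ⊆ {y : G.edgeSet → ℝ | (m : ℝ) + 1 ≤ ∑ e, y e} :=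
    convexHull_min (fun y hy => hy.2) (convex_le_sum _)
  have hAP : convexHull ℝ A ⊆ edmondsPolytope G := by
    rw [edmondsPolytope_eq_convexHull]; exact convexHull_mono fun y hy => hy.1
  have hBP : convexHull ℝ B ⊆ edmondsPolytope G := by
    rw [edmondsPolytope_eq_convexHull]; exact convexHull_mono fun y hy => hy.1
  rcases Set.eq_empty_or_nonempty B with hB | hB
  · -- no matching with `≥ m + 1` edges: then `x(E) ≤ m`, contradiction
    rw [hB, Set.union_empty] at hxconv
    have := hAle hxconv
    simp only [Set.mem_setOf_eq] at this
    linarith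
  rw [convexHull_union hA hB, mem_convexJoin] at hxconv
  obtain ⟨a, ha, b, hb, hseg⟩ := hxconv
  have hfa : ∑ e, a e ≤ m := hAle ha
  have hfb : (m : ℝ) + 1 ≤ ∑ e, b e := hBge hb
  have haP : a ∈ edmondsPolytope G := hAP ha
  have hbP : b ∈ edmondsPolytope G := hBP hb
  rw [segment_eq_image] at hseg
  obtain ⟨θ, ⟨hθ0, hθ1⟩, hxθ⟩ := hseg
  -- the parametrised segment and the value of `x(E)` along it
  set fa := ∑ e, a e with hfa_def
  set fb := ∑ e, b e with hfb_def
  set D := fb - fa with hD_def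
  have hD : 0 < D := by rw [hD_def]; linarith
  have hp : ∀ t : ℝ, ∑ e, ((1 - t) • a + t • b) e = fa + t * D := by
    intro t; rw [sum_combo]; ring
  have hsx : ∑ e, x e = fa + θ * D := by rw [← hxθ]; exact hp θ
  -- parameters of the points with `x(E) = m` and `x(E) = m + 1`
  set t₁ := ((m : ℝ) - fa) / D with ht₁_def
  set t₂ := ((m : ℝ) + 1 - fa) / D with ht₂_def
  have ht₁D : t₁ * D = m - fa := by rw [ht₁_def]; field_simp
  have ht₂D : t₂ * D = m + 1 - fa := by rw [ht₂_def]; field_simp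
  have ht₁0 : 0 ≤ t₁ := div_nonneg (by linarith) hD.le
  have ht₂1 : t₂ ≤ 1 := by rw [ht₂_def, div_le_one hD]; linarith
  have ht₁θ : t₁ ≤ θ := by
    by_contra hlt
    push Not at hlt
    have := mul_lt_mul_of_pos_right hlt hD
    rw [ht₁D] at this
    linarith
  have hθt₂ : θ ≤ t₂ := by
    by_contra hlt
    push Not at hlt
    have := mul_lt_mul_of_pos_right hlt hD
    rw [ht₂D] at this
    linarith
  have ht₁1 : t₁ ≤ 1 := ht₁θ.trans hθ1
  have ht₂0 : 0 ≤ t₂ := hθ0.trans hθt₂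
  have ht₁₂ : t₁ < t₂ := by
    have h : t₁ * D < t₂ * D := by rw [ht₁D, ht₂D]; linarith
    exact lt_of_mul_lt_mul_right h hD.le
  -- the two points
  set p₁ := (1 - t₁) • a + t₁ • b with hp₁_def
  set p₂ := (1 - t₂) • a + t₂ • b with hp₂_def
  have hseg_sub : segment ℝ a b ⊆ edmondsPolytope G := convex_edmondsPolytope.segment_subset haP hbP
  have hp₁P : p₁ ∈ edmondsPolytope G := by
    refine hseg_sub ?_
    rw [segment_eq_image]
    exact ⟨t₁, ⟨ht₁0, ht₁1⟩, rfl⟩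
  have hp₂P : p₂ ∈ edmondsPolytope G := by
    refine hseg_sub ?_
    rw [segment_eq_image]
    exact ⟨t₂, ⟨ht₂0, ht₂1⟩, rfl⟩
  have hp₁s : ∑ e, p₁ e = (m : ℕ) := by rw [hp₁_def, hp, ht₁D]; ring
  have hp₂s : ∑ e, p₂ e = ((m + 1 : ℕ) : ℝ) := by rw [hp₂_def, hp, ht₂D]; push_cast; ring
  have hp₁C : p₁ ∈ convexHull ℝ (cardMatchingVectorsOf G m ∪ cardMatchingVectorsOf G (m + 1)) := by
    refine convexHull_mono Set.subset_union_left ?_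
    rw [convexHull_cardMatchingVectorsOf_eq]
    exact ⟨hp₁P, hp₁s⟩
  have hp₂C : p₂ ∈ convexHull ℝ (cardMatchingVectorsOf G m ∪ cardMatchingVectorsOf G (m + 1)) := by
    refine convexHull_mono Set.subset_union_right ?_
    rw [convexHull_cardMatchingVectorsOf_eq]
    exact ⟨hp₂P, hp₂s⟩
  -- `x` between them
  set μ := (θ - t₁) / (t₂ - t₁) with hμ_def
  have h21 : 0 < t₂ - t₁ := by linarith
  have hμ0 : 0 ≤ μ := div_nonneg (by linarith) h21.le
  have hμ1 : μ ≤ 1 := by rw [hμ_def, div_le_one h21]; linarith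
  have hμt : (1 - μ) * t₁ + μ * t₂ = θ := by
    rw [hμ_def]; field_simp; ring
  have hxμ : x = (1 - μ) • p₁ + μ • p₂ := by
    rw [← hxθ, hp₁_def, hp₂_def]
    funext e
    simp only [Pi.add_apply, Pi.smul_apply, smul_eq_mul]
    rw [← hμt]
    ring
  rw [hxμ]
  exact convex_convexHull ℝ _ hp₁C hp₂C (by linarith) hμ0 (by ring)

/-! ## §3. The range theorem -/

/-- **THEOREM (matchings with a cardinality range).** For every finite simple graph `G` and naturals
`k, l`: `conv{χ^M : M a matching of G, k ≤ |M| ≤ l} = {x ∈ P_match(G) : k ≤ x(E) ≤ l}`, where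
`P_match(G)` is Edmonds' polytope `{x ≥ 0, x(δ(v)) ≤ 1, x(E(S)) ≤ (|S|−1)/2 (|S| odd)}`.
(For `k > l` both sides are empty; for `k = l` this is the slice theorem.)
[cite: Schrijver2003, §18.5f (the bipartite case, "Matchings of given size")]
[cite: KaibelWalter2017, §3 (arXiv p. 6: the slice `x(E) = k`)] [cite: Edmonds1965, §2 Thm. (P) (p. 126)] -/
theorem convexHull_rangeMatchingVectors_eq (k l : ℕ) :
    convexHull ℝ (rangeMatchingVectors G k l) = edmondsRange G k l := by
  classical
  refine Set.Subset.antisymm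
    (convexHull_min (rangeMatchingVectors_subset_edmondsRange k l) (convex_edmondsRange k l)) ?_
  rintro x ⟨hx, hk, hl⟩
  set s := ∑ e, x e with hs_def
  have hs0 : 0 ≤ s := le_trans (Nat.cast_nonneg k) hk
  set m := ⌊s⌋₊ with hm_def
  have hms : (m : ℝ) ≤ s := Nat.floor_le hs0
  have hsm : s < m + 1 := Nat.lt_floor_add_one s
  have hkm : k ≤ m := by
    have h : (k : ℝ) < m + 1 := lt_of_le_of_lt hk hsm
    have h' : k < m + 1 := by exact_mod_cast h
    omega
  rcases eq_or_lt_of_le hms with heq | hlt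
  · -- `x(E) = m` : the slice theorem
    have hml : m ≤ l := by
      have h : (m : ℝ) ≤ l := by rw [heq]; exact hl
      exact_mod_cast h
    refine convexHull_mono (cardMatchingVectorsOf_subset_rangeMatchingVectors hkm hml) ?_
    rw [convexHull_cardMatchingVectorsOf_eq]
    exact ⟨hx, heq.symm⟩
  · -- `m < x(E) < m + 1` : between two slices
    have hml : m + 1 ≤ l := by
      have h : (m : ℝ) < l := lt_of_lt_of_le hlt hl
      have h' : m < l := by exact_mod_cast h
      omega
    refine convexHull_mono ?_ (mem_convexHull_union_slices hx hlt hsm)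
    exact Set.union_subset (cardMatchingVectorsOf_subset_rangeMatchingVectors hkm (by omega))
      (cardMatchingVectorsOf_subset_rangeMatchingVectors (by omega) hml)

/-- Membership form: `x ∈ conv{k ≤ |M| ≤ l}` iff `x` satisfies Edmonds' inequalities and
`k ≤ x(E) ≤ l`. [cite: Schrijver2003, §18.5f (the bipartite case)] [cite: KaibelWalter2017, §3 (arXiv p. 6)] -/
theorem mem_convexHull_rangeMatchingVectors_iff (k l : ℕ) (x : G.edgeSet → ℝ) :
    x ∈ convexHull ℝ (rangeMatchingVectors G k l) ↔
      x ∈ edmondsPolytope G ∧ (k : ℝ) ≤ ∑ e, x e ∧ ∑ e, x e ≤ l := by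
  rw [convexHull_rangeMatchingVectors_eq]; rfl

/-- **The vertices of the slab are exactly the matching vectors in the range** (a 0-1 point is extreme in
a subset of the unit cube containing it). [cite: KaibelWalter2017, §3 (arXiv p. 6)] [cite: Edmonds1965, §2 Thm. (P) (p. 126)] -/
theorem extremePoints_edmondsRange (k l : ℕ) :
    (edmondsRange G k l).extremePoints ℝ = rangeMatchingVectors G k l := by
  refine Set.Subset.antisymm ?_ ?_
  · rw [← convexHull_rangeMatchingVectors_eq]
    exact extremePoints_convexHull_subset
  · intro y hy
    refine ⟨rangeMatchingVectors_subset_edmondsRange k l hy, fun x₁ hx₁ x₂ hx₂ hseg => ?_⟩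
    suffices h : ∀ e, x₁ e = x₂ e by
      obtain rfl : x₁ = x₂ := funext h
      rw [openSegment_same, Set.mem_singleton_iff] at hseg
      exact hseg.symm
    intro e
    have h₁ : y e ∈ openSegment ℝ (x₁ e) (x₂ e) :=
      image_openSegment ℝ (LinearMap.proj e : (G.edgeSet → ℝ) →ₗ[ℝ] ℝ).toAffineMap x₁ x₂ ▸
        ⟨_, hseg, rfl⟩
    by_contra hne
    have h₂ : openSegment ℝ (x₁ e) (x₂ e) ⊆ Set.Ioo 0 1 := by
      rw [openSegment_eq_Ioo' hne]
      exact Set.Ioo_subset_Ioo (le_min (hx₁.1.1 e) (hx₂.1.1 e))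
        (max_le (le_one_of_mem_edmondsPolytope hx₁.1 e) (le_one_of_mem_edmondsPolytope hx₂.1 e))
    have h₃ := h₂ h₁
    rcases hy.1.1 e with h | h <;> rw [h] at h₃ <;> simp at h₃

/-! ## §4. One-sided versions -/

/-- **At most `l` edges**: `conv{χ^M : |M| ≤ l} = {x ∈ P_match(G) : x(E) ≤ l}`.
[cite: Schrijver2003, §18.5f (the bipartite case)] [cite: KaibelWalter2017, §3 (arXiv p. 6)] -/
theorem convexHull_matchingVectors_sum_le_eq (l : ℕ) :
    convexHull ℝ {x | x ∈ matchingVectors G ∧ ∑ e, x e ≤ l} =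
      {x | x ∈ edmondsPolytope G ∧ ∑ e, x e ≤ l} := by
  have h1 : {x | x ∈ matchingVectors G ∧ ∑ e, x e ≤ l} = rangeMatchingVectors G 0 l := by
    ext x
    simp only [rangeMatchingVectors, Set.mem_setOf_eq, Nat.cast_zero]
    exact ⟨fun h => ⟨h.1, Finset.sum_nonneg fun e _ => (matchingVectors_subset_edmondsPolytope h.1).1 e,
      h.2⟩, fun h => ⟨h.1, h.2.2⟩⟩
  have h2 : {x | x ∈ edmondsPolytope G ∧ ∑ e, x e ≤ l} = edmondsRange G 0 l := by
    ext x
    simp only [edmondsRange, Set.mem_setOf_eq, Nat.cast_zero]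
    exact ⟨fun h => ⟨h.1, Finset.sum_nonneg fun e _ => h.1.1 e, h.2⟩, fun h => ⟨h.1, h.2.2⟩⟩
  rw [h1, h2]
  exact convexHull_rangeMatchingVectors_eq 0 l

/-- **At least `k` edges**: `conv{χ^M : k ≤ |M|} = {x ∈ P_match(G) : k ≤ x(E)}` (every point of
`P_match(G)` has `x(E) ≤ |V|/2 ≤ |V|`, tree `two_mul_sum_le_card`).
[cite: Schrijver2003, §18.5f (the bipartite case)] [cite: KaibelWalter2017, §3 (arXiv p. 6)] -/
theorem convexHull_matchingVectors_le_sum_eq (k : ℕ) :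
    convexHull ℝ {x | x ∈ matchingVectors G ∧ (k : ℝ) ≤ ∑ e, x e} =
      {x | x ∈ edmondsPolytope G ∧ (k : ℝ) ≤ ∑ e, x e} := by
  have hb : ∀ x ∈ edmondsPolytope G, ∑ e, x e ≤ (Fintype.card V : ℕ) := by
    intro x hx
    have h := two_mul_sum_le_card hx
    have h0 : 0 ≤ ∑ e, x e := Finset.sum_nonneg fun e _ => hx.1 e
    linarith
  have h1 : {x | x ∈ matchingVectors G ∧ (k : ℝ) ≤ ∑ e, x e} =
      rangeMatchingVectors G k (Fintype.card V) := by
    ext x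
    simp only [rangeMatchingVectors, Set.mem_setOf_eq]
    exact ⟨fun h => ⟨h.1, h.2, hb x (matchingVectors_subset_edmondsPolytope h.1)⟩,
      fun h => ⟨h.1, h.2.1⟩⟩
  have h2 : {x | x ∈ edmondsPolytope G ∧ (k : ℝ) ≤ ∑ e, x e} = edmondsRange G k (Fintype.card V) := by
    ext x
    simp only [edmondsRange, Set.mem_setOf_eq]
    exact ⟨fun h => ⟨h.1, h.2, hb x h.1⟩, fun h => ⟨h.1, h.2.1⟩⟩
  rw [h1, h2]
  exact convexHull_rangeMatchingVectors_eq k (Fintype.card V)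

end CardMatchingSlice

end Literature.Combinatorics.Optimization
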